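import Summits.PneNP.PneNP.Theorems.ChebyshevTracialDesignTightFreeTwoSided
import Summits.PneNP.PneNP.Theorems.ChebyshevTracialDesignPerCutPinnedPartners
import Summits.PneNP.PneNP.Theorems.ChebyshevTracialDesignFreeBoundedDimension
import HarnessLib

/-!
# Cell pnp-psdrank, route `ChebyshevTracialDesign`: second moments of edge-type fields are FREE on tight-free supports, and the crux holds —
# two-sidedly, at its own dimension budget — for SUPPORT-TIGHT psd strategies (crux `TracialDecayExp20`, stmt-PneNP-19878)

Brick 173b (prover g34; MEMO-37 §1), on top of brick 173a (`…TightFreeTwoSided`: `|Σ_{A×B} W| ≤ e^{−a·dq n}` on tight-free rectangles, and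
`|Σ W g h| ≤ 4γ` for signed `|g|,|h| ≤ 1` with tight-free support). Two-sided smallness survives signed combinations, so:
* §1 **`abs_sum_edgeField_sq_le_of_tightFree`** (design-free) — for a mask `0 ≤ f ≤ 1`, a signed tilt `|h| ≤ 1` with `f(U)h(M) = 0` on the
  tight pairs and any pair weighting `|ν| ≤ 1`: `|Σ_U f(U) Σ_M W(U,M)·C_{h(M)·ν∘π_M}(U)²| ≤ n⁴γ`, `C_v(U) = Σ_p v_p x_p x_{π_M p}` — the masked,
  tilted SECOND MOMENT OF AN EDGE-TYPE FIELD (MEMO-36 §2(c)'s corrected open instance (PC-ν)) is two-sidedly free as soon as the mask × tilt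
  support is tight-free: brick 171's pinned-partner expansion `perCut_edgeField_eq_sum_pinned` turns it into `n⁴` signed weighted rectangles
  with tight-free support. No spreadness, no sign-coherence of `ν`, no structure of `h`. So the open content of (PC-ν) is carried ENTIRELY by
  mask × tilt pairs meeting the tight pairs — which (PC) must allow, having dropped the orthogonality clause (brick 84: inessential for the
  crux; but it is exactly what two-sidedness needs).
* §2 **`abs_value_le_of_supportTight`** (design-free) — for psd contractions `X_U, Y_M` of dimension `r` that are SUPPORT-TIGHT (`cc(U,M) = 1 ⇒
  X_U = 0 ∨ Y_M = 0`, the combinatorial strengthening of `X_U Y_M = 0`): `|Σ_{U,M} W·tr(X_U Y_M)| ≤ 4r²γ` (entrywise: `r²` signed pairs with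
  tight-free support, entries of a psd contraction are in `[−1,1]`, brick 85b's `abs_entry_le_one`).
* §3 design corollaries (unconditional): **`edgeField_sq_tightFree_decay`** (`≤ n⁴·e^{−a·dq n}`) and **`tracialDecayExp_supportTight_holds`**:
  for some `a > 0`, all large even `n`, every balanced design and EVERY dimension `r ≥ 1` with `r²n < e^{a·dq n}`, every support-tight psd
  rectangle has `|Σ W·tr(X_U Y_M)|/r ≤ e^{−a·dq n}` — the crux's conclusion (two-sided) on the class where tightness is achieved by disjoint
  supports rather than by orthogonality (`a = a₀/2`: `4r²e^{−a₀D} ≤ r·e^{−a₀D/2}` once `r < e^{a₀D/4}`, `4 ≤ e^{a₀D/4}`). By brick 42 the wider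
  class `X_U Y_M = 0` contains the squared-slack strategy of dimension `C(n,2)+1` with value EXACTLY `−1/(normalisation)` (polynomially large,
  negative): two-sidedness holds for support-tightness and fails for orthogonality-tightness — the crux is intrinsically one-sided exactly on
  the strategies outside this file's class.
[cite: Rothvoss2017, §2 and Lemma 7 (PDF pp. 6–8)] [cite: KeevashLifshitz2023, Thm. 1.8] [cite: GriblingDelaatLaurent2019, §5]
[cite: BrietDadushPokutta2014, Thm. 6 (§3)]
Stature: support/instrument (kernel lane, no defs, axioms standard; bookkeeping over brick 173a). WHAT THIS IS NOT: nothing on masks/tilts whose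
support meets the tight pairs (that is (PC)/(PC-ν), OPEN), no proof or refutation of `TracialDecayExp20`, nothing on psd rank of P_PM(K_n) beyond
the rungs, no P-vs-NP content. Supports stmt-PneNP-19878.
-/

set_option linter.dupNamespace false -- `Summit.PneNP.PneNP.…`: summit = sub-problem (D-0017)

noncomputable section

namespace Summit.PneNP.PneNP.Theorems.ChebyshevTracialDesignSupportTightStrategies

open Finset Matrix Literature.Combinatorics.Optimization
open Literature.Barriers.PneNP hiding verts
open Summit.PneNP.PneNP.Theorems.ChebyshevTracialDesignTightFreeTwoSided
open Summit.PneNP.PneNP.Theorems.ChebyshevTracialDesignPerCutPinnedPartners (perCut_edgeField_eq_sum_pinned)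
open Summit.PneNP.PneNP.Theorems.ChebyshevTracialDesignFreeBoundedDimension (abs_entry_le_one)

variable {n : ℕ}

/-! ### §1 Second moments of edge-type fields on tight-free supports -/

/-- **THE EDGE-FIELD SECOND MOMENT IS TWO-SIDEDLY FREE ON TIGHT-FREE SUPPORTS.** Let `W` be any weight whose tight-free rectangles have
`|mass| ≤ γ`, `f : cuts → [0,1]` a mask and `h : PM → [−1,1]` a (signed) tilt such that `f(U)h(M)` vanishes on the tight pairs
(`cc(U,M) = 1 ⇒ f(U) = 0 ∨ h(M) = 0`), and `ν` a pair weighting with `|ν| ≤ 1`. Then the masked, tilted containment second moment of the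
edge-type field `v_M(p) = h(M)·ν(p, π_M p)` (MEMO-36 §2(c), brick 171) satisfies
`|Σ_U f(U)·Σ_M W(U,M)·(Σ_p h(M)ν(p,π_M p)·x_p x_{π_M p})²| ≤ n⁴·γ`:
brick 171's pinned-partner expansion writes the left side as `Σ_{p,p',q,q'} ν(p,p')ν(q,q')·Σ_{U,M} W·(f x_px_{p'}x_qx_{q'})(U)·(h²·1[π_Mp = p']·
1[π_Mq = q'])(M)`, `n⁴` weighted rectangles with tight-free support, each two-sidedly `≤ γ` (§2). No spreadness, no sign coherence of `ν`,
no structure of `h` is needed — only that the support avoids the tight pairs. [cite: Rothvoss2017, §2 and Lemma 7 (PDF pp. 6–8)]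
[cite: GriblingDelaatLaurent2019, §5] -/
theorem abs_sum_edgeField_sq_le_of_tightFree (W : OddSet n → PMatch n → ℝ) {γ : ℝ}
    (hR : ∀ (A : Finset (OddSet n)) (B : Finset (PMatch n)), (∀ U ∈ A, ∀ M ∈ B, cc U M ≠ 1) →
      |∑ U ∈ A, ∑ M ∈ B, W U M| ≤ γ)
    (f : OddSet n → ℝ) (hf : ∀ U, 0 ≤ f U ∧ f U ≤ 1) (h : PMatch n → ℝ) (hh : ∀ M, |h M| ≤ 1)
    (hT : ∀ U M, cc U M = 1 → f U = 0 ∨ h M = 0) (ν : Fin n → Fin n → ℝ) (hν : ∀ p p', |ν p p'| ≤ 1) :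
    |∑ U : OddSet n, f U * ∑ M : PMatch n, W U M *
        (∑ p, (h M * ν p (M.2.partner p)) * ((if p ∈ U.1 then (1 : ℝ) else 0) * (if M.2.partner p ∈ U.1 then (1 : ℝ) else 0))) ^ 2| ≤
      (n : ℝ) ^ 4 * γ := by
  classical
  have hγ : 0 ≤ γ := by
    have := hR ∅ ∅ (by simp)
    simpa using this
  -- brick 171's expansion, per cut, then the mask inside and the sums swapped
  have hexp : ∑ U : OddSet n, f U * ∑ M : PMatch n, W U M *
        (∑ p, (h M * ν p (M.2.partner p)) * ((if p ∈ U.1 then (1 : ℝ) else 0) * (if M.2.partner p ∈ U.1 then (1 : ℝ) else 0))) ^ 2 =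
      ∑ p, ∑ p', ∑ q, ∑ q', (ν p p' * ν q q') * ∑ U : OddSet n, ∑ M : PMatch n, W U M *
        ((f U * (((if p ∈ U.1 then (1 : ℝ) else 0) * (if p' ∈ U.1 then (1 : ℝ) else 0)) *
          ((if q ∈ U.1 then (1 : ℝ) else 0) * (if q' ∈ U.1 then (1 : ℝ) else 0)))) *
          (h M ^ 2 * ((if p' = M.2.partner p then (1 : ℝ) else 0) * (if q' = M.2.partner q then (1 : ℝ) else 0)))) := by
    have h1 : ∀ U : OddSet n, f U * ∑ M : PMatch n, W U M *
        (∑ p, (h M * ν p (M.2.partner p)) * ((if p ∈ U.1 then (1 : ℝ) else 0) * (if M.2.partner p ∈ U.1 then (1 : ℝ) else 0))) ^ 2 =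
        ∑ p, ∑ p', ∑ q, ∑ q', (ν p p' * ν q q') * ∑ M : PMatch n, W U M *
          ((f U * (((if p ∈ U.1 then (1 : ℝ) else 0) * (if p' ∈ U.1 then (1 : ℝ) else 0)) *
            ((if q ∈ U.1 then (1 : ℝ) else 0) * (if q' ∈ U.1 then (1 : ℝ) else 0)))) *
            (h M ^ 2 * ((if p' = M.2.partner p then (1 : ℝ) else 0) * (if q' = M.2.partner q then (1 : ℝ) else 0)))) := by
      intro U
      rw [perCut_edgeField_eq_sum_pinned W U h ν, mul_sum]
      refine sum_congr rfl fun p _ => ?_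
      rw [mul_sum]
      refine sum_congr rfl fun p' _ => ?_
      rw [mul_sum]
      refine sum_congr rfl fun q _ => ?_
      rw [mul_sum]
      refine sum_congr rfl fun q' _ => ?_
      rw [mul_left_comm, mul_sum, mul_sum]
      refine congrArg _ (sum_congr rfl fun M _ => ?_)
      ring
    rw [sum_congr rfl fun U _ => h1 U, sum_comm]
    refine sum_congr rfl fun p _ => ?_
    rw [sum_comm]
    refine sum_congr rfl fun p' _ => ?_
    rw [sum_comm]
    refine sum_congr rfl fun q _ => ?_
    rw [sum_comm]
    refine sum_congr rfl fun q' _ => ?_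
    rw [← mul_sum]
  rw [hexp]
  -- each of the `n⁴` weighted rectangles has tight-free support
  have hind : ∀ (P : Prop) [Decidable P], 0 ≤ (if P then (1 : ℝ) else 0) ∧ (if P then (1 : ℝ) else 0) ≤ 1 := by
    intro P _; split_ifs <;> norm_num
  have hterm : ∀ p p' q q' : Fin n, |∑ U : OddSet n, ∑ M : PMatch n, W U M *
        ((f U * (((if p ∈ U.1 then (1 : ℝ) else 0) * (if p' ∈ U.1 then (1 : ℝ) else 0)) *
          ((if q ∈ U.1 then (1 : ℝ) else 0) * (if q' ∈ U.1 then (1 : ℝ) else 0)))) *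
          (h M ^ 2 * ((if p' = M.2.partner p then (1 : ℝ) else 0) * (if q' = M.2.partner q then (1 : ℝ) else 0))))| ≤ γ := by
    intro p p' q q'
    refine abs_sum_mul_mul_le_of_tightFree W hR _ _ (fun U => ?_) (fun M => ?_) (fun U M h1 => ?_)
    · obtain ⟨hf0, hf1⟩ := hf U
      obtain ⟨a0, a1⟩ := hind (p ∈ U.1)
      obtain ⟨b0, b1⟩ := hind (p' ∈ U.1)
      obtain ⟨c0, c1⟩ := hind (q ∈ U.1)
      obtain ⟨d0, d1⟩ := hind (q' ∈ U.1)
      refine ⟨by positivity, ?_⟩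
      calc f U * (((if p ∈ U.1 then (1 : ℝ) else 0) * (if p' ∈ U.1 then (1 : ℝ) else 0)) *
            ((if q ∈ U.1 then (1 : ℝ) else 0) * (if q' ∈ U.1 then (1 : ℝ) else 0))) ≤ 1 * ((1 * 1) * (1 * 1)) := by
            gcongr
        _ = 1 := by ring
    · have hsq : h M ^ 2 ≤ 1 := by
        have := hh M
        rw [abs_le] at this
        nlinarith
      obtain ⟨a0, a1⟩ := hind (p' = M.2.partner p)
      obtain ⟨b0, b1⟩ := hind (q' = M.2.partner q)
      refine ⟨by positivity, ?_⟩
      calc h M ^ 2 * ((if p' = M.2.partner p then (1 : ℝ) else 0) * (if q' = M.2.partner q then (1 : ℝ) else 0)) ≤ 1 * (1 * 1) := by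
            gcongr
        _ = 1 := by ring
    · rcases hT U M h1 with h0 | h0
      · exact Or.inl (by rw [h0, zero_mul])
      · exact Or.inr (by rw [h0]; ring)
  have hn4 : ((n : ℝ) ^ 4) * γ = ∑ _p : Fin n, ∑ _p' : Fin n, ∑ _q : Fin n, ∑ _q' : Fin n, γ := by
    simp only [sum_const, card_univ, Fintype.card_fin]
    ring
  rw [hn4]
  refine le_trans (abs_sum_le_sum_abs _ _) (sum_le_sum fun p _ => ?_)
  refine le_trans (abs_sum_le_sum_abs _ _) (sum_le_sum fun p' _ => ?_)
  refine le_trans (abs_sum_le_sum_abs _ _) (sum_le_sum fun q _ => ?_)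
  refine le_trans (abs_sum_le_sum_abs _ _) (sum_le_sum fun q' _ => ?_)
  rw [abs_mul]
  have hνb : |ν p p' * ν q q'| ≤ 1 := by
    rw [abs_mul]
    calc |ν p p'| * |ν q q'| ≤ 1 * 1 := mul_le_mul (hν p p') (hν q q') (abs_nonneg _) zero_le_one
      _ = 1 := by ring
  calc |ν p p' * ν q q'| * _ ≤ 1 * γ := mul_le_mul hνb (hterm p p' q q') (abs_nonneg _) zero_le_one
    _ = γ := one_mul _

/-! ### §2 Support-tight psd strategies of every dimension -/

/-- **SUPPORT-TIGHT PSD RECTANGLES ARE TWO-SIDEDLY FREE AT EVERY DIMENSION.** Let `W` be any weight whose tight-free rectangles have `|mass| ≤ γ`,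
and `X_U, Y_M` psd contractions of dimension `r` (`0 ⪯ X_U, Y_M ⪯ I`) that are SUPPORT-TIGHT: `cc(U,M) = 1 ⇒ X_U = 0 ∨ Y_M = 0`. Then
`|Σ_{U,M} W(U,M)·tr(X_U Y_M)| ≤ 4r²γ`: entrywise, `tr(X_U Y_M) = Σ_{i,j} X_U(i,j)·Y_M(j,i)` is a sum of `r²` signed weighted rectangles with
tight-free support and entries in `[−1,1]`. [cite: BrietDadushPokutta2014, Thm. 6 (§3)] [cite: Rothvoss2017, §2 and Lemma 7 (PDF pp. 6–8)] -/
theorem abs_value_le_of_supportTight (W : OddSet n → PMatch n → ℝ) {γ : ℝ}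
    (hR : ∀ (A : Finset (OddSet n)) (B : Finset (PMatch n)), (∀ U ∈ A, ∀ M ∈ B, cc U M ≠ 1) →
      |∑ U ∈ A, ∑ M ∈ B, W U M| ≤ γ)
    {r : ℕ} (X : OddSet n → Matrix (Fin r) (Fin r) ℝ) (Y : PMatch n → Matrix (Fin r) (Fin r) ℝ)
    (hX : ∀ U, (X U).PosSemidef ∧ (1 - X U).PosSemidef) (hY : ∀ M, (Y M).PosSemidef ∧ (1 - Y M).PosSemidef)
    (hT : ∀ U M, cc U M = 1 → X U = 0 ∨ Y M = 0) :
    |∑ U, ∑ M, W U M * (X U * Y M).trace| ≤ 4 * (r : ℝ) ^ 2 * γ := by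
  classical
  have hexp : ∑ U, ∑ M, W U M * (X U * Y M).trace = ∑ i : Fin r, ∑ j : Fin r, ∑ U, ∑ M, W U M * (X U i j * Y M j i) := by
    have h1 : ∀ U M, W U M * (X U * Y M).trace = ∑ i : Fin r, ∑ j : Fin r, W U M * (X U i j * Y M j i) := by
      intro U M
      rw [Matrix.trace, mul_sum]
      refine sum_congr rfl fun i _ => ?_
      rw [Matrix.diag_apply, Matrix.mul_apply, mul_sum]
    calc ∑ U, ∑ M, W U M * (X U * Y M).trace
        = ∑ U, ∑ M, ∑ i : Fin r, ∑ j : Fin r, W U M * (X U i j * Y M j i) := by simp_rw [h1]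
      _ = ∑ U, ∑ i : Fin r, ∑ M, ∑ j : Fin r, W U M * (X U i j * Y M j i) := sum_congr rfl fun U _ => Finset.sum_comm
      _ = ∑ i : Fin r, ∑ U, ∑ M, ∑ j : Fin r, W U M * (X U i j * Y M j i) := Finset.sum_comm
      _ = ∑ i : Fin r, ∑ U, ∑ j : Fin r, ∑ M, W U M * (X U i j * Y M j i) :=
          sum_congr rfl fun i _ => sum_congr rfl fun U _ => Finset.sum_comm
      _ = ∑ i : Fin r, ∑ j : Fin r, ∑ U, ∑ M, W U M * (X U i j * Y M j i) := sum_congr rfl fun i _ => Finset.sum_comm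
  rw [hexp]
  have hterm : ∀ i j : Fin r, |∑ U, ∑ M, W U M * (X U i j * Y M j i)| ≤ 4 * γ := by
    intro i j
    refine abs_sum_mul_mul_le_of_tightFree_signed W hR (fun U => X U i j) (fun M => Y M j i)
      (fun U => abs_entry_le_one (hX U) i j) (fun M => abs_entry_le_one (hY M) j i) fun U M h1 => ?_
    rcases hT U M h1 with h0 | h0
    · exact Or.inl (by rw [h0]; rfl)
    · exact Or.inr (by rw [h0]; rfl)
  have hr2 : 4 * (r : ℝ) ^ 2 * γ = ∑ _i : Fin r, ∑ _j : Fin r, 4 * γ := by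
    simp only [sum_const, card_univ, Fintype.card_fin]
    ring
  rw [hr2]
  refine le_trans (abs_sum_le_sum_abs _ _) (sum_le_sum fun i _ => ?_)
  exact le_trans (abs_sum_le_sum_abs _ _) (sum_le_sum fun j _ => hterm i j)

/-! ### §3 Design corollaries (unconditional) -/

/-- **THE EDGE-FIELD SECOND MOMENT ON TIGHT-FREE SUPPORTS DECAYS TWO-SIDEDLY — UNCONDITIONAL**: for some `a > 0` and all large even `n`, every
balanced exact design of degree `dq n` with `Σ|w| ≤ 20`, every mask `0 ≤ f ≤ 1` and signed tilt `|h| ≤ 1` with `f(U)h(M) = 0` on the tight pairs,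
and every pair weighting `|ν| ≤ 1`: `|Σ_U f(U) Σ_M W(U,M)·C_{h(M)·ν∘π_M}(U)²| ≤ n⁴·e^{−a·dq n}`. (MEMO-36's (PC-ν) asks this one-sidedly WITHOUT the
support condition; this is the part of it that is free.) [cite: Rothvoss2017, §2 and Lemma 7 (PDF pp. 6–8)] [cite: KeevashLifshitz2023, Thm. 1.8]
[cite: GriblingDelaatLaurent2019, §5] -/
theorem edgeField_sq_tightFree_decay :
    ∃ a : ℝ, 0 < a ∧ ∃ n₁ : ℕ, ∀ n : ℕ, n₁ ≤ n → Even n → ∀ (t : ℕ) (C : Finset ℕ) (w : ℕ → ℝ),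
      IsBalancedDesign n t (Tq n) (dq n) 20 C w →
        ∀ (f : OddSet n → ℝ), (∀ U, 0 ≤ f U ∧ f U ≤ 1) → ∀ (h : PMatch n → ℝ), (∀ M, |h M| ≤ 1) →
          (∀ U M, cc U M = 1 → f U = 0 ∨ h M = 0) → ∀ (ν : Fin n → Fin n → ℝ), (∀ p p', |ν p p'| ≤ 1) →
          |∑ U : OddSet n, f U * ∑ M : PMatch n, levelWeight n t C w U M *
              (∑ p, (h M * ν p (M.2.partner p)) *
                ((if p ∈ U.1 then (1 : ℝ) else 0) * (if M.2.partner p ∈ U.1 then (1 : ℝ) else 0))) ^ 2| ≤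
            (n : ℝ) ^ 4 * Real.exp (-(a * (dq n : ℝ))) := by
  obtain ⟨a, ha, n₁, hrung⟩ := abs_rectangleDecayExp_holds
  exact ⟨a, ha, n₁, fun n hn hev t C w hdes f hf h hh hT ν hν =>
    abs_sum_edgeField_sq_le_of_tightFree _ (hrung n hn hev t C w hdes) f hf h hh hT ν hν⟩

/-- **THE CRUX ON SUPPORT-TIGHT PSD STRATEGIES — UNCONDITIONAL, TWO-SIDED, AT THE CRUX'S OWN DIMENSION BUDGET.** For some `a > 0` and all large
even `n`: for every balanced exact design of degree `dq n` with `Σ|w| ≤ 20`, every dimension `r ≥ 1` with `r²·n < e^{a·dq n}`, and every pair of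
psd contraction fields `X_U, Y_M` of dimension `r` with `X_U = 0 ∨ Y_M = 0` whenever `cc(U,M) = 1`:
`|Σ_{U,M} W(U,M)·tr(X_U Y_M)| / r ≤ e^{−a·dq n}`. (With `a₀` the rate of §1 and `a = a₀/2`: `4r²e^{−a₀ D}/r ≤ 4e^{a₀D/4}e^{−a₀D} ≤ e^{−a₀D/2}` once
`e^{a₀D/4} ≥ 4`.) The crux `TracialDecayExp20` asks the one-sided bound for the wider class `X_U Y_M = 0`; by brick 42 that class contains the
squared-slack strategy of dimension `C(n,2)+1`, whose value is exactly `−1/(normalisation)` — so the two-sided form is special to support-tightness.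
[cite: BrietDadushPokutta2014, Thm. 6 (§3)] [cite: Rothvoss2017, §2 and Lemma 7 (PDF pp. 6–8)] [cite: KeevashLifshitz2023, Thm. 1.8] -/
theorem tracialDecayExp_supportTight_holds :
    ∃ a : ℝ, 0 < a ∧ ∃ n₁ : ℕ, ∀ n : ℕ, n₁ ≤ n → Even n → ∀ (t : ℕ) (C : Finset ℕ) (w : ℕ → ℝ),
      IsBalancedDesign n t (Tq n) (dq n) 20 C w → ∀ r : ℕ, 0 < r → (r : ℝ) ^ 2 * n < Real.exp (a * (dq n : ℝ)) →
        ∀ (X : OddSet n → Matrix (Fin r) (Fin r) ℝ) (Y : PMatch n → Matrix (Fin r) (Fin r) ℝ),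
          (∀ U, (X U).PosSemidef ∧ (1 - X U).PosSemidef) → (∀ M, (Y M).PosSemidef ∧ (1 - Y M).PosSemidef) →
          (∀ U M, cc U M = 1 → X U = 0 ∨ Y M = 0) →
          |∑ U, ∑ M, levelWeight n t C w U M * (X U * Y M).trace| / r ≤ Real.exp (-(a * (dq n : ℝ))) := by
  obtain ⟨a₀, ha₀, n₁, hrung⟩ := abs_rectangleDecayExp_holds
  -- `a = a₀/2`; threshold: `dq n ≥ D₁` with `e^{a₀ D₁/4} ≥ 4`
  obtain ⟨D₁, hD₁⟩ : ∃ D₁ : ℕ, D₁ = ⌈8 / a₀⌉₊ := ⟨_, rfl⟩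
  refine ⟨a₀ / 2, by positivity, max n₁ (max (D₁ ^ 4) 1), ?_⟩
  intro n hn hev t C w hdes r hr hbud X Y hX hY hT
  have hn₁ : n₁ ≤ n := le_trans (le_max_left _ _) hn
  have hD₁n : D₁ ^ 4 ≤ n := le_trans ((le_max_left _ _).trans (le_max_right _ _)) hn
  have hn1 : 1 ≤ n := le_trans ((le_max_right _ _).trans (le_max_right _ _)) hn
  have hD : D₁ ≤ dq n := by
    unfold dq
    rw [Nat.le_sqrt, Nat.le_sqrt]
    calc D₁ * D₁ * (D₁ * D₁) = D₁ ^ 4 := by ring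
      _ ≤ n := hD₁n
  have haD : 8 ≤ a₀ * dq n := by
    have h1 : 8 / a₀ ≤ (dq n : ℝ) := (Nat.le_ceil _).trans (by rw [← hD₁]; exact_mod_cast hD)
    rwa [div_le_iff₀ ha₀, mul_comm] at h1
  have hval := abs_value_le_of_supportTight _ (hrung n hn₁ hev t C w hdes) X Y hX hY hT
  have hr0 : (0 : ℝ) < r := by exact_mod_cast hr
  rw [div_le_iff₀ hr0]
  refine hval.trans ?_
  -- `4 r² e^{−a₀D} ≤ e^{−a₀D/2}·r`, using `r < e^{a₀D/4}` (from the budget `r² ≤ r²n < e^{a₀D/2}`) and `4 ≤ e^{a₀D/4}`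
  set D : ℝ := (dq n : ℝ) with hDdef
  have hD0 : 0 ≤ D := by rw [hDdef]; exact Nat.cast_nonneg _
  have hr1 : (1 : ℝ) ≤ r := by exact_mod_cast hr
  have hrsq : (r : ℝ) ^ 2 < Real.exp (a₀ / 2 * D) := by
    have hn1' : (1 : ℝ) ≤ n := by exact_mod_cast hn1
    calc (r : ℝ) ^ 2 = (r : ℝ) ^ 2 * 1 := (mul_one _).symm
      _ ≤ (r : ℝ) ^ 2 * n := mul_le_mul_of_nonneg_left hn1' (by positivity)
      _ < Real.exp (a₀ / 2 * D) := hbud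
  have hr4 : (r : ℝ) ≤ Real.exp (a₀ / 4 * D) := by
    have h1 : Real.exp (a₀ / 2 * D) = Real.exp (a₀ / 4 * D) ^ 2 := by
      rw [← Real.exp_nat_mul]; congr 1; push_cast; ring
    rw [h1] at hrsq
    exact le_of_lt (pow_lt_pow_iff_left₀ (by positivity) (Real.exp_pos _).le two_ne_zero |>.1 hrsq)
  have h4 : (4 : ℝ) ≤ Real.exp (a₀ / 4 * D) := by
    have h1 : (2 : ℝ) ≤ a₀ / 4 * D := by linarith
    have h2 : Real.exp 2 ≤ Real.exp (a₀ / 4 * D) := Real.exp_le_exp.2 h1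
    have h3 : (4 : ℝ) ≤ Real.exp 2 := by
      have := Real.add_one_le_exp (1 : ℝ)
      have h' : Real.exp 2 = Real.exp 1 ^ 2 := by rw [← Real.exp_nat_mul]; norm_num
      rw [h']; nlinarith
    linarith
  have hkey : 4 * (r : ℝ) ^ 2 * Real.exp (-(a₀ * D)) ≤ Real.exp (-(a₀ / 2 * D)) * r := by
    have h1 : 4 * (r : ℝ) ≤ Real.exp (a₀ / 4 * D) * Real.exp (a₀ / 4 * D) :=
      mul_le_mul h4 hr4 (by positivity) (Real.exp_pos _).le
    have h2 : Real.exp (a₀ / 4 * D) * Real.exp (a₀ / 4 * D) * Real.exp (-(a₀ * D)) = Real.exp (-(a₀ / 2 * D)) := by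
      rw [← Real.exp_add, ← Real.exp_add]; congr 1; ring
    calc 4 * (r : ℝ) ^ 2 * Real.exp (-(a₀ * D)) = (4 * r) * Real.exp (-(a₀ * D)) * r := by ring
      _ ≤ (Real.exp (a₀ / 4 * D) * Real.exp (a₀ / 4 * D)) * Real.exp (-(a₀ * D)) * r := by
          gcongr
      _ = Real.exp (-(a₀ / 2 * D)) * r := by rw [h2]
  exact hkey

end Summit.PneNP.PneNP.Theorems.ChebyshevTracialDesignSupportTightStrategies
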